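import Summits.AtomisticToContinuum.BoseEinsteinCondensation.Theorems.BECConjugateDominationHardCoreExtensionMaxFormApproximationFiniteRangeStep
import HarnessLib

/-!
# MaxFormApproximation for hard cores, part 3/3: stub `stub_maxFormApproximationFiniteRange` (S-B) of line
# `near-minimiser-slack-transfer`, crux `BECConjugateDomination.HardCoreExtension` (stmt-AtomisticToContinuum-11786)

**MaxFormApproximation for every repulsive finite-range pair potential, hard cores included** (B. Simon's "maximal
form = minimal form" in the Bose sector of the torus `(ℝ³/Lℤ³)^N`): for `L > 0`, a UNIT `η ∈ L²((ℝ/ℤ)^{3N})` (Haar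
probability measure) Bose-symmetric in momentum space with finite maximal-form energy
`Q_v(η) = ∑ₙ (∑ₚ (2πnₚ/L)²)|⟪eₙ, η⟫|² + ∫ (W_v ∘ fromUnitTorusN L)|η|²`, and `ε > 0`, there is a periodic Bose `C¹`
trial state `Φ` with `periodicEnergy v Φ ≤ Q_v(η) + ε` and `‖ι₀Φ - η‖ ≤ ε` for the free embedding
`ι₀ = formEmbed ∘ graphEmbed` of `PeriodicFormDomain.lean` (auxiliary profile `0`): the normalised `C¹` Bose core is
STRONGLY dense in the unit sphere of the maximal form domain.

Proof. No hard radii (`hardRad v = ∅`): the interaction is integrable on the cell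
(`lintegral_norm_ne_top_of_hardRad_eq_empty`) and the landed integrable case `exists_trialState_maxForm_approx`
applies. Otherwise: clamp `η` (`tendsto_clampLp`: `ζ = clampC k ∘ η` is within `e/2` of `η`, bounded, Bose-symmetric,
and its kinetic / potential maximal-form energies are not larger — `tsum_kinetic_clampLp_le`,
`lintegral_pot_clampLp_le`), so `ζ` has hard-layer decay (`hardLayer_decay_of_bound`); the cut-off step
`maxFormApproximation_cutoffStep` (part 2) gives a core function `Φ` with `Q_v(ι₀Φ) ≤ (1 + e/2) Q_v(η) + e/2` and
`‖ι₀Φ - η‖ ≤ e`; normalise (`|‖ι₀Φ‖ - 1| ≤ e`, `(1 - e)⁻² ≤ 1 + 6e`) with `e = min (1/4) (ε/(8q + 8))`, `q = Q_v(η)`.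

References: B. Simon, *Maximal and minimal Schrödinger forms*, J. Operator Theory 1 (1979) 37–47, Thm. 2.1;
[ReedSimonIV1978] Thm. XIII.64; T. Kato, *Perturbation Theory*, VI §1.
-/

noncomputable section

namespace Summit.AtomisticToContinuum.BoseEinsteinCondensation.Cruxes.HardCoreExtension.NearMinTower

open MeasureTheory Filter Set
open scoped ENNReal NNReal Topology
open Literature.MathematicalPhysics.QuantumManyBody.BoseGas
open Literature.Analysis.FunctionSpaces Literature.Analysis.OperatorTheory
open UnitAddTorus
open Summit.AtomisticToContinuum.BoseEinsteinCondensation.Cruxes.StaticResponseBound.UvThomsonForceWave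
  (measurable_zeroProfile lintegral_periodicInteraction_zero_ne_top)

attribute [local instance] Literature.MathematicalPhysics.QuantumManyBody.BoseGas.formDomain_measureSpace
  Literature.MathematicalPhysics.QuantumManyBody.BoseGas.formDomain_isProbabilityMeasure
  Literature.MathematicalPhysics.QuantumManyBody.BoseGas.formDomain_isProbabilityMeasure_pi

open scoped InnerProductSpace

/-- **Stub S-B `stub_maxFormApproximationFiniteRange`** (line `near-minimiser-slack-transfer`, crux
`HardCoreExtension`): **MaxFormApproximation for every repulsive finite-range pair potential, hard cores included** — for `L > 0`, a unit
Bose-symmetric `η ∈ L²((ℝ/ℤ)^{3N})` with finite maximal-form energy `Q_v(η)` and `ε > 0` there is a periodic Bose `C¹`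
trial state `Φ` with `periodicEnergy v Φ ≤ Q_v(η) + ε` and `‖ι₀Φ - η‖ ≤ ε` (free embedding `ι₀`): the normalised core is
strongly dense in the unit sphere of the maximal form domain. No hard radii: the landed integrable case
`exists_trialState_maxForm_approx`. Otherwise: clamp `η` (`tendsto_clampLp`; the clamp is bounded, Bose-symmetric and
does not increase the maximal form), get hard-layer decay (`hardLayer_decay_of_bound`), run the cut-off step
`maxFormApproximation_cutoffStep`, and normalise. [cite: ReedSimonIV1978, Thm. XIII.64] -/
theorem stub_maxFormApproximationFiniteRange :
    ∀ v : ℝ → ℝ≥0∞, IsRepulsiveFiniteRange v → ∀ (N : ℕ) (L : ℝ) (hL : 0 < L),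
      ∀ η : Lp ℂ 2 (volume : Measure (UnitAddTorus (Fin N × Fin 3))), ‖η‖ = 1 →
        (∀ (σ : Equiv.Perm (Fin N)) (n : Fin N × Fin 3 → ℤ),
          ⟪(mFourierLp 2 (fun p : Fin N × Fin 3 => n (σ p.1, p.2)) :
              Lp ℂ 2 (volume : Measure (UnitAddTorus (Fin N × Fin 3)))), η⟫_ℂ =
            ⟪(mFourierLp 2 n : Lp ℂ 2 (volume : Measure (UnitAddTorus (Fin N × Fin 3)))), η⟫_ℂ) →
        (∑' n : Fin N × Fin 3 → ℤ, ENNReal.ofReal (∑ p, (2 * Real.pi * (n p : ℝ) / L) ^ 2) *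
              (‖⟪(mFourierLp 2 n : Lp ℂ 2 (volume : Measure (UnitAddTorus (Fin N × Fin 3)))), η⟫_ℂ‖₊ :
                ℝ≥0∞) ^ 2 +
            ∫⁻ t, periodicInteraction v L (fromUnitTorusN L t) *
              (‖(η : UnitAddTorus (Fin N × Fin 3) → ℂ) t‖₊ : ℝ≥0∞) ^ 2) ≠ ⊤ →
        ∀ ε : ℝ, 0 < ε → ∃ Φ : PeriodicTrialState N L,
          periodicEnergy v Φ ≤
            (∑' n : Fin N × Fin 3 → ℤ, ENNReal.ofReal (∑ p, (2 * Real.pi * (n p : ℝ) / L) ^ 2) *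
                (‖⟪(mFourierLp 2 n : Lp ℂ 2 (volume : Measure (UnitAddTorus (Fin N × Fin 3)))), η⟫_ℂ‖₊ :
                  ℝ≥0∞) ^ 2 +
              ∫⁻ t, periodicInteraction v L (fromUnitTorusN L t) *
                (‖(η : UnitAddTorus (Fin N × Fin 3) → ℂ) t‖₊ : ℝ≥0∞) ^ 2) + ENNReal.ofReal ε ∧
          ‖formEmbed hL measurable_zeroProfile (lintegral_periodicInteraction_zero_ne_top N L)
              ⟨graphEmbed hL measurable_zeroProfile (lintegral_periodicInteraction_zero_ne_top N L)
                ⟨Φ.ψ, Φ.mem_periodicCore⟩,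
                graphEmbed_mem_formDomain hL measurable_zeroProfile
                  (lintegral_periodicInteraction_zero_ne_top N L) _⟩ - η‖ ≤ ε := by
  intro v hv N L hL η hη hsymm hfin ε hε
  obtain ⟨R₀, hv0⟩ := hv.2
  rcases (hardRad v).eq_empty_or_nonempty with hS | hS
  · -- no hard radii: the interaction is integrable on the cell
    exact exists_trialState_maxForm_approx hL measurable_zeroProfile (lintegral_periodicInteraction_zero_ne_top N L)
      hv.1 (lintegral_cellN_periodicInteraction_ne_top_of_lintegral_ne_top hL hv.1
        (lintegral_norm_ne_top_of_hardRad_eq_empty hv0 hS) N) η hη hsymm hfin hε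
  -- notation
  set Q : ℝ≥0∞ := ∑' n : Fin N × Fin 3 → ℤ, ENNReal.ofReal (∑ p, (2 * Real.pi * (n p : ℝ) / L) ^ 2) *
      (‖⟪(mFourierLp 2 n : Lp ℂ 2 (volume : Measure (UnitAddTorus (Fin N × Fin 3)))), η⟫_ℂ‖₊ : ℝ≥0∞) ^ 2 +
    ∫⁻ t, periodicInteraction v L (fromUnitTorusN L t) * (‖(η : UnitAddTorus (Fin N × Fin 3) → ℂ) t‖₊ : ℝ≥0∞) ^ 2
    with hQdef
  set q : ℝ := Q.toReal with hqdef
  have hq0 : 0 ≤ q := ENNReal.toReal_nonneg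
  have hQq : Q = ENNReal.ofReal q := (ENNReal.ofReal_toReal hfin).symm
  have hKV := ENNReal.add_ne_top.1 hfin
  -- the accuracy `e = min (1/4) (ε / (8q + 8))`
  set e : ℝ := min (1 / 4) (ε / (8 * q + 8)) with hedef
  have he0 : 0 < e := lt_min (by norm_num) (by positivity)
  have he4 : e ≤ 1 / 4 := min_le_left _ _
  have heε : e * (8 * q + 8) ≤ ε := by
    have h := min_le_right (1 / 4) (ε / (8 * q + 8))
    rw [← hedef] at h
    have h88 : 0 < 8 * q + 8 := by positivity
    calc e * (8 * q + 8) ≤ ε / (8 * q + 8) * (8 * q + 8) := mul_le_mul_of_nonneg_right h h88.le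
      _ = ε := div_mul_cancel₀ ε h88.ne'
  have he2 : 2 * e ≤ ε := by nlinarith [mul_nonneg he0.le hq0]
  -- the clamp truncation `ζ` within `e/2` of `η`
  obtain ⟨k, hk⟩ := ((tendsto_iff_norm_sub_tendsto_zero.1 (tendsto_clampLp η)).eventually
    (Iic_mem_nhds (half_pos he0))).exists
  obtain ⟨ζ, hζ⟩ : ∃ ζ : Lp ℂ 2 (volume : Measure (UnitAddTorus (Fin N × Fin 3))),
      ζ = (lipschitzWith_clampC (k : ℝ)).compLp (clampC_zero (Nat.cast_nonneg k)) η := ⟨_, rfl⟩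
  have hζK := tsum_kinetic_clampLp_le (L := L) η k
  have hζV := lintegral_pot_clampLp_le η k (fun t => periodicInteraction v L (fromUnitTorusN L t))
  have hζsymm := inner_symm_clampLp η k hsymm
  have hζbd := ae_norm_clampLp_le η k
  rw [← hζ] at hk hζK hζV hζsymm hζbd
  replace hk : ‖ζ - η‖ ≤ e / 2 := hk
  -- hard-layer decay of `ζ` and the cut-off step at accuracy `e/2`
  have hlayer : ∀ ε' : ℝ, 0 < ε' → ∃ s₀ : ℝ, 0 < s₀ ∧ ∀ s : ℝ, 0 < s → s ≤ s₀ →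
      ∫⁻ t in fromUnitTorusN L ⁻¹' (hardLayer v L s : Set (Config N)),
        ((‖(ζ : UnitAddTorus (Fin N × Fin 3) → ℂ) t‖₊ : ℝ≥0∞)) ^ 2 ≤ ENNReal.ofReal (ε' * s ^ 2) := fun ε' hε' =>
    hardLayer_decay_of_bound hL hv.1 (fun b hb => le_of_mem_hardRad hv0 hb) hS ζ hζbd
      (ne_top_of_le_ne_top hKV.1 hζK) (ne_top_of_le_ne_top hKV.2 hζV) hε'
  obtain ⟨Φc, hΦcE, hΦcd⟩ :=
    maxFormApproximation_cutoffStep v hv.1 R₀ hv0 N L hL ζ hζsymm hlayer (e / 2) (half_pos he0)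
  obtain ⟨P, hP⟩ : ∃ P : Lp ℂ 2 (volume : Measure (UnitAddTorus (Fin N × Fin 3))),
      P = formEmbed hL measurable_zeroProfile (lintegral_periodicInteraction_zero_ne_top N L)
        ⟨graphEmbed hL measurable_zeroProfile (lintegral_periodicInteraction_zero_ne_top N L) Φc,
          graphEmbed_mem_formDomain hL measurable_zeroProfile (lintegral_periodicInteraction_zero_ne_top N L) Φc⟩ :=
    ⟨_, rfl⟩
  rw [← hP] at hΦcE hΦcd
  have hQP : (∑' n : Fin N × Fin 3 → ℤ, ENNReal.ofReal (∑ p, (2 * Real.pi * (n p : ℝ) / L) ^ 2) *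
        (‖⟪(mFourierLp 2 n : Lp ℂ 2 (volume : Measure (UnitAddTorus (Fin N × Fin 3)))), P⟫_ℂ‖₊ : ℝ≥0∞) ^ 2 +
      ∫⁻ t, periodicInteraction v L (fromUnitTorusN L t) *
        (‖(P : UnitAddTorus (Fin N × Fin 3) → ℂ) t‖₊ : ℝ≥0∞) ^ 2) ≤
      ENNReal.ofReal (1 + e / 2) * Q + ENNReal.ofReal (e / 2) :=
    hΦcE.trans (add_le_add (mul_le_mul_right (add_le_add hζK hζV) _) le_rfl)
  have hdist : ‖P - η‖ ≤ e :=
    calc ‖P - η‖ ≤ ‖P - ζ‖ + ‖ζ - η‖ := norm_sub_le_norm_sub_add_norm_sub _ _ _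
      _ ≤ e / 2 + e / 2 := add_le_add hΦcd hk
      _ = e := add_halves e
  -- `‖P‖` is close to `1`; normalise
  have hPnorm : |‖P‖ - 1| ≤ e := by
    rw [← hη]
    exact (abs_norm_sub_norm_le P η).trans hdist
  have hPpos : 0 < ‖P‖ := by
    have := (abs_le.1 hPnorm).1
    linarith
  set c : ℝ := ‖P‖⁻¹ with hcdef
  have hc0 : 0 < c := inv_pos.2 hPpos
  set Φc' : periodicCore N L := ((c : ℝ) : ℂ) • Φc with hΦc'
  have hιΦ : formEmbed hL measurable_zeroProfile (lintegral_periodicInteraction_zero_ne_top N L)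
      ⟨graphEmbed hL measurable_zeroProfile (lintegral_periodicInteraction_zero_ne_top N L) Φc',
        graphEmbed_mem_formDomain hL measurable_zeroProfile (lintegral_periodicInteraction_zero_ne_top N L) Φc'⟩ =
      ((c : ℝ) : ℂ) • P := by
    rw [hP, ← map_smul]
    congr 1
    apply Subtype.ext
    simp only [hΦc', map_smul, SetLike.mk_smul_mk]
  have h1 : ‖formEmbed hL measurable_zeroProfile (lintegral_periodicInteraction_zero_ne_top N L)
      ⟨graphEmbed hL measurable_zeroProfile (lintegral_periodicInteraction_zero_ne_top N L) Φc',
        graphEmbed_mem_formDomain hL measurable_zeroProfile (lintegral_periodicInteraction_zero_ne_top N L) Φc'⟩‖ =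
      1 := by
    rw [hιΦ, norm_smul, Complex.norm_real, Real.norm_of_nonneg hc0.le, hcdef, inv_mul_cancel₀ hPpos.ne']
  refine ⟨PeriodicTrialState.ofCore hL measurable_zeroProfile (lintegral_periodicInteraction_zero_ne_top N L) Φc' h1,
    ?_, ?_⟩
  · -- the energy
    rw [periodicEnergy_eq_maxForm hL measurable_zeroProfile (lintegral_periodicInteraction_zero_ne_top N L) hv.1]
    have hcore : (⟨(PeriodicTrialState.ofCore hL measurable_zeroProfile (lintegral_periodicInteraction_zero_ne_top N L)
        Φc' h1).ψ, (PeriodicTrialState.ofCore hL measurable_zeroProfile (lintegral_periodicInteraction_zero_ne_top N L)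
        Φc' h1).mem_periodicCore⟩ : periodicCore N L) = Φc' := rfl
    rw [hcore, hιΦ, tsum_weight_inner_smul, lintegral_weight_smul_sq, ← mul_add, Complex.norm_real,
      Real.norm_of_nonneg hc0.le]
    -- `c² ((1 + e/2) Q + e/2) ≤ (1 + 6e)((1 + e/2) q + e/2) ≤ q + ε`
    have hc2 : c ^ 2 ≤ 1 + 6 * e := by
      have hle : 1 - e ≤ ‖P‖ := by linarith [(abs_le.1 hPnorm).1]
      have h1e : 0 < 1 - e := by linarith
      calc c ^ 2 = (‖P‖ ^ 2)⁻¹ := by rw [hcdef, inv_pow]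
        _ ≤ ((1 - e) ^ 2)⁻¹ := by
            refine inv_anti₀ (by positivity) ?_
            exact pow_le_pow_left₀ h1e.le hle 2
        _ ≤ 1 + 6 * e := inv_sq_one_sub_le he0.le he4
    have hreal : (1 + 6 * e) * ((1 + e / 2) * q + e / 2) ≤ q + ε := by
      have h1 : 0 ≤ (1 / 4 - e) * (e * q) := mul_nonneg (by linarith) (mul_nonneg he0.le hq0)
      have h2 : 0 ≤ (1 / 4 - e) * e := mul_nonneg (by linarith) he0.le
      have h3 : 0 ≤ e * q := mul_nonneg he0.le hq0
      nlinarith [h1, h2, h3, heε, he0.le]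
    calc ENNReal.ofReal (c ^ 2) * _
        ≤ ENNReal.ofReal (1 + 6 * e) * (ENNReal.ofReal (1 + e / 2) * Q + ENNReal.ofReal (e / 2)) :=
          mul_le_mul' (ENNReal.ofReal_le_ofReal hc2) hQP
      _ = ENNReal.ofReal ((1 + 6 * e) * ((1 + e / 2) * q + e / 2)) := by
          rw [hQq, ← ENNReal.ofReal_mul (by linarith), ← ENNReal.ofReal_add (by positivity) (by positivity),
            ← ENNReal.ofReal_mul (by linarith)]
      _ ≤ ENNReal.ofReal (q + ε) := ENNReal.ofReal_le_ofReal hreal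
      _ = Q + ENNReal.ofReal ε := by rw [ENNReal.ofReal_add hq0 hε.le, ← hQq]
  · -- the distance
    have hcore : (⟨(PeriodicTrialState.ofCore hL measurable_zeroProfile (lintegral_periodicInteraction_zero_ne_top N L)
        Φc' h1).ψ, (PeriodicTrialState.ofCore hL measurable_zeroProfile (lintegral_periodicInteraction_zero_ne_top N L)
        Φc' h1).mem_periodicCore⟩ : periodicCore N L) = Φc' := rfl
    rw [hcore, hιΦ]
    calc ‖((c : ℝ) : ℂ) • P - η‖ ≤ ‖((c : ℝ) : ℂ) • P - P‖ + ‖P - η‖ := norm_sub_le_norm_sub_add_norm_sub _ _ _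
      _ = |c - 1| * ‖P‖ + ‖P - η‖ := by
          rw [show ((c : ℝ) : ℂ) • P - P = (((c - 1 : ℝ)) : ℂ) • P by
            rw [Complex.ofReal_sub, Complex.ofReal_one, sub_smul, one_smul], norm_smul, Complex.norm_real,
            Real.norm_eq_abs]
      _ = |1 - ‖P‖| + ‖P - η‖ := by
          rw [hcdef, show ‖P‖⁻¹ - 1 = (1 - ‖P‖) * ‖P‖⁻¹ by field_simp, abs_mul, abs_of_pos (inv_pos.2 hPpos),
            mul_assoc, inv_mul_cancel₀ hPpos.ne', mul_one]
      _ ≤ e + e := add_le_add (by rw [abs_sub_comm]; exact hPnorm) hdist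
      _ ≤ ε := by linarith

end Summit.AtomisticToContinuum.BoseEinsteinCondensation.Cruxes.HardCoreExtension.NearMinTower

end
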